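import Mathlib
import Summits.NavierStokesRegularity.NavierStokesRegularity.Theses.PlaneEnergyCeiling
import Summits.NavierStokesRegularity.NavierStokesRegularity.Theorems.PlaneEnergyCeilingPlanarEnergyAPrioriHardyCeiling

/-!
# Route PlaneEnergyCeiling · crux `PlanarEnergyAPriori` — the ceiling persists to the final slice

Helper file for the crux item stmt-NavierStokesRegularity-16855 (`PlanarEnergyAPriori`, route
`PlaneEnergyCeiling`), landed `--supports` that item. The crux bounds the planar energies of a
classical Leray–Hopf solution for `t < T` only; at a (potential) blow-up time `T` the solution is
seen through the single slice `u T`, the weak-`L²` limit pinned by the Leray–Hopf clause. This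
file passes the ceiling to that slice:

* `setLIntegral_sq_final_le` — weak lower semicontinuity on a fixed measurable set `S`: if
  `∫_S |u(t)|² ≤ B` on a final stretch `t ∈ (T₁, T)`, then `∫_S |u(T)|² ≤ B` (weak `L²`
  continuity of Leray–Hopf solutions at `t = T`, tested against `1_S u(T)`, and
  `⟪a,b⟫ ≤ (|a|² + |b|²)/2` — no compactness);
* `dirSlab_final_le` — hence a planar bound `M` on `[0,T)` gives the slab bounds
  `∫_{c−δ<⟪y,e⟫<c+δ} |u(T)|² ≤ 2δM` in EVERY direction at the final time (planes themselves are
  null sets for the measurable slice `u T`; slabs are the honest trace of the ceiling);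
* `hardyCeiling_final` — and, by the Radon back-projection inequality (`stub_rieszCeiling`), the
  HARDY CEILING AT THE FINAL TIME `∫ |u(T,y)|²/|y − x₀| dy ≤ 2M` at every centre, with the
  scaled-energy form `∫_{B_r(x₀)} |u(T)|² ≤ 2rM` (`ball_final_le`);
* `PlanarEnergyAPriori.hardyCeiling_final` / `hardyCeiling_final_of_planarEnergyAPriori`
  (registered form) — GIVEN the crux, the time-`T` profile of every classical Leray–Hopf
  solution from a rapidly decaying datum has a bounded Newtonian potential of `|u(T)|²`; in
  particular no `|y − x₀|⁻¹` final-time profile (log-divergent potential) can occur.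

This is step (3) of the endgame stub of the sibling line `radon_topside` (crux
`BoundedPlanarEnergyRegularity`): "slab bounds pass to `u(T)` by weak lower semicontinuity, the
Riesz ceiling gives `∫|u(T)|²/|y−x₀| ≤ 2M`". Folklore functional analysis.
-/

noncomputable section

-- single-conjunct summit: `Summit.<Summit>.<Problem>` repeats the name by the D-0017 layout
set_option linter.dupNamespace false

namespace Summit.NavierStokesRegularity.NavierStokesRegularity.Theorems.PlanarEnergyAPriori

open MeasureTheory Set Filter Topology WithLp Metric
open scoped ENNReal RealInnerProductSpace
open Literature.Analysis.FluidPDE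
open Summit.NavierStokesRegularity.NavierStokesRegularity.Theorems.BoundedPlanarEnergyRegularity
  (stub_rieszCeiling)

variable {ν T : ℝ} {u : ℝ → EuclideanSpace ℝ (Fin 3) → EuclideanSpace ℝ (Fin 3)}
  {u₀ : EuclideanSpace ℝ (Fin 3) → EuclideanSpace ℝ (Fin 3)}
  {p : ℝ → EuclideanSpace ℝ (Fin 3) → ℝ}

/-! ## Weak lower semicontinuity at the final time -/

/-- For an `L²` field `f` and a measurable set `S`, `∫ ⟪f, 1_S f⟫ = ∫_S ‖f‖²`. -/
theorem integral_inner_indicator_self {f : EuclideanSpace ℝ (Fin 3) → EuclideanSpace ℝ (Fin 3)}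
    {S : Set (EuclideanSpace ℝ (Fin 3))} (hS : MeasurableSet S) :
    ∫ x, ⟪f x, S.indicator f x⟫ = ∫ x in S, ‖f x‖ ^ 2 := by
  rw [← integral_indicator hS]
  congr 1 with x
  by_cases hx : x ∈ S
  · rw [indicator_of_mem hx, indicator_of_mem hx, real_inner_self_eq_norm_sq]
  · rw [indicator_of_notMem hx, indicator_of_notMem hx, inner_zero_right]

/-- The real set integral of `‖f‖²` is the real part of the lower integral of `‖f‖ₑ²`. -/
theorem setIntegral_norm_sq_eq_toReal {f : EuclideanSpace ℝ (Fin 3) → EuclideanSpace ℝ (Fin 3)}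
    (hf : AEStronglyMeasurable f volume) (S : Set (EuclideanSpace ℝ (Fin 3))) :
    ∫ x in S, ‖f x‖ ^ 2 = (∫⁻ x in S, ‖f x‖ₑ ^ 2).toReal := by
  have hm : AEStronglyMeasurable (fun x => ‖f x‖ ^ 2) (volume.restrict S) :=
    (continuous_pow 2).comp_aestronglyMeasurable hf.norm.restrict
  rw [integral_eq_lintegral_of_nonneg_ae (Eventually.of_forall fun x => by positivity) hm]
  congr 1
  refine lintegral_congr fun x => ?_
  rw [← ofReal_norm, ENNReal.ofReal_pow (norm_nonneg _)]

/-- Slices of a Leray–Hopf solution have finite energy on every set: `∫_S ‖u(t)‖ₑ² < ∞`,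
`t ∈ [0,T]`. -/
theorem setLIntegral_sq_ne_top (hLH : IsLerayHopfOn T ν 0 u₀ u) {t : ℝ} (ht : t ∈ Icc 0 T)
    (S : Set (EuclideanSpace ℝ (Fin 3))) : ∫⁻ x in S, ‖u t x‖ₑ ^ 2 ≠ ⊤ := by
  have hi : Integrable (fun x => ‖u t x‖ ^ 2) volume :=
    (memLp_two_iff_integrable_sq_norm (hLH.memLp t ht).1).1 (hLH.memLp t ht)
  have h1 : ∫⁻ x, ‖u t x‖ₑ ^ 2 = ∫⁻ x, ENNReal.ofReal (‖u t x‖ ^ 2) := lintegral_congr fun x => by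
    rw [← ofReal_norm, ENNReal.ofReal_pow (norm_nonneg _)]
  exact ne_top_of_le_ne_top (h1 ▸ hi.lintegral_lt_top.ne) (setLIntegral_le_lintegral S _)

/-- **Weak lower semicontinuity at the final time, on a fixed set.** Let `u` be Leray–Hopf on
`[0,T]` and `S` measurable. If `∫_S |u(t)|² ≤ B` for all `t` in a final stretch `(T₁, T)`, then
`∫_S |u(T)|² ≤ B`: test the weak `L²` continuity of `u` at `T` against `w = 1_S u(T)` and use
`⟪u(t), u(T)⟫ ≤ (|u(t)|² + |u(T)|²)/2`. [folklore] -/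
theorem setLIntegral_sq_final_le (hLH : IsLerayHopfOn T ν 0 u₀ u) (hT : 0 < T)
    {S : Set (EuclideanSpace ℝ (Fin 3))} (hS : MeasurableSet S) {T₁ : ℝ} (hT₁ : T₁ < T)
    {B : ℝ} (hB : 0 ≤ B)
    (hbound : ∀ t ∈ Ioo T₁ T, ∫⁻ x in S, ‖u t x‖ₑ ^ 2 ≤ ENNReal.ofReal B) :
    ∫⁻ x in S, ‖u T x‖ₑ ^ 2 ≤ ENNReal.ofReal B := by
  have hTmem : T ∈ Icc 0 T := ⟨hT.le, le_rfl⟩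
  set L : ℝ → ℝ≥0∞ := fun t => ∫⁻ x in S, ‖u t x‖ₑ ^ 2 with hL
  have hreal : ∀ t ∈ Icc 0 T, ∫ x in S, ‖u t x‖ ^ 2 = (L t).toReal := fun t ht =>
    setIntegral_norm_sq_eq_toReal (hLH.memLp t ht).1 S
  have hsq : ∀ t ∈ Icc 0 T, Integrable (fun x => ‖u t x‖ ^ 2) volume := fun t ht =>
    (memLp_two_iff_integrable_sq_norm (hLH.memLp t ht).1).1 (hLH.memLp t ht)
  -- the test field `w = 1_S u(T)` and the tested quantity `g`
  set w : EuclideanSpace ℝ (Fin 3) → EuclideanSpace ℝ (Fin 3) := S.indicator (u T) with hw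
  have hwmem : MemLp w 2 volume := (hLH.memLp T hTmem).indicator hS
  set g : ℝ → ℝ := fun t => ∫ x, ⟪u t x, w x⟫ with hg
  have hcont : ContinuousOn g (Ioc 0 T) := (hLH.weak_continuous w hwmem).1
  have htend : Tendsto g (𝓝[<] T) (𝓝 (g T)) := by
    have h1 : ContinuousWithinAt g (Ioo 0 T) T :=
      (hcont T ⟨hT, le_rfl⟩).mono Ioo_subset_Ioc_self
    simpa only [nhdsWithin_Ioo_eq_nhdsLT hT] using h1.tendsto
  have hgT : g T = (L T).toReal := by
    simp only [hg, hw]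
    rw [integral_inner_indicator_self hS, hreal T hTmem]
  -- the bound before `T`
  have hgt : ∀ t ∈ Ioo (max T₁ 0) T, g t ≤ (B + (L T).toReal) / 2 := by
    intro t ht
    have ht0 : t ∈ Icc 0 T := ⟨(le_max_right _ _).trans ht.1.le, ht.2.le⟩
    have htu : MemLp (u t) 2 volume := hLH.memLp t ht0
    have hpt : ∀ x, ⟪u t x, w x⟫ ≤
        (S.indicator (fun x => ‖u t x‖ ^ 2) x + S.indicator (fun x => ‖u T x‖ ^ 2) x) / 2 := by
      intro x
      by_cases hx : x ∈ S
      · simp only [hw, indicator_of_mem hx]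
        nlinarith [real_inner_le_norm (u t x) (u T x), sq_nonneg (‖u t x‖ - ‖u T x‖)]
      · simp only [hw, indicator_of_notMem hx, inner_zero_right]
        norm_num
    have hint_lhs : Integrable (fun x => ⟪u t x, w x⟫) volume :=
      (htu.norm.integrable_mul hwmem.norm).mono' (htu.1.inner hwmem.1)
        (ae_of_all _ fun x => norm_inner_le_norm (u t x) (w x))
    have hint_rhs : Integrable (fun x =>
        (S.indicator (fun x => ‖u t x‖ ^ 2) x + S.indicator (fun x => ‖u T x‖ ^ 2) x) / 2) volume :=
      (((hsq t ht0).indicator hS).add ((hsq T hTmem).indicator hS)).div_const 2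
    calc g t ≤ ∫ x, (S.indicator (fun x => ‖u t x‖ ^ 2) x + S.indicator (fun x => ‖u T x‖ ^ 2) x) / 2 :=
          integral_mono hint_lhs hint_rhs hpt
      _ = ((∫ x in S, ‖u t x‖ ^ 2) + ∫ x in S, ‖u T x‖ ^ 2) / 2 := by
          rw [integral_div, integral_add ((hsq t ht0).indicator hS) ((hsq T hTmem).indicator hS),
            integral_indicator hS, integral_indicator hS]
      _ ≤ (B + (L T).toReal) / 2 := by
          rw [hreal t ht0, hreal T hTmem]
          gcongr
          exact ENNReal.toReal_le_of_le_ofReal hB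
            (hbound t ⟨(le_max_left _ _).trans_lt ht.1, ht.2⟩)
  -- pass to the limit `t ↑ T`
  have hlim : (L T).toReal ≤ (B + (L T).toReal) / 2 := by
    have hev : ∀ᶠ t in 𝓝[<] T, g t ≤ (B + (L T).toReal) / 2 := by
      filter_upwards [Ioo_mem_nhdsLT (max_lt hT₁ hT)] with t ht using hgt t ht
    have := le_of_tendsto htend hev
    rwa [hgT] at this
  have hLT : (L T).toReal ≤ B := by linarith
  calc L T = ENNReal.ofReal (L T).toReal := (ENNReal.ofReal_toReal (setLIntegral_sq_ne_top hLH hTmem S)).symm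
    _ ≤ ENNReal.ofReal B := ENNReal.ofReal_le_ofReal hLT

/-! ## The planar ceiling at the final time: slabs, Hardy potential, balls -/

/-- **Slab bounds at the final time, every direction.** If a classical solution on `[0,T)`,
Leray–Hopf on `[0,T]`, has planar energies `≤ M` on a final stretch `(T₁,T)` (all `R`, `c`),
then its final slice obeys `∫_{c−δ<⟪y,e⟫<c+δ} |u(T)|² ≤ 2δM` for every unit `e`, offset `c`
and `δ > 0`. -/
theorem dirSlab_final_le (hT : 0 < T) (hcl : IsClassicalNSSolutionOn (Ico 0 T) ν 0 u p)
    (hLH : IsLerayHopfOn T ν 0 u₀ u) {T₁ : ℝ} (hT₁ : T₁ < T) {M : ℝ} (hM : 0 ≤ M)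
    (hpl : ∀ t ∈ Ioo T₁ T, ∀ (R : EuclideanSpace ℝ (Fin 3) ≃ₗᵢ[ℝ] EuclideanSpace ℝ (Fin 3)) (c : ℝ),
      ∫⁻ y : EuclideanSpace ℝ (Fin 2), ‖u t (R (toLp 2 ![y 0, y 1, c]))‖ₑ ^ 2 ≤ ENNReal.ofReal M)
    {e : EuclideanSpace ℝ (Fin 3)} (he : ‖e‖ = 1) (c : ℝ) {δ : ℝ} (hδ : 0 < δ) :
    ∫⁻ y in {y : EuclideanSpace ℝ (Fin 3) | c - δ < ⟪y, e⟫ ∧ ⟪y, e⟫ < c + δ}, ‖u T y‖ₑ ^ 2 ≤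
      ENNReal.ofReal (2 * δ * M) := by
  have hSm : MeasurableSet {y : EuclideanSpace ℝ (Fin 3) | c - δ < ⟪y, e⟫ ∧ ⟪y, e⟫ < c + δ} := by
    have hc : Continuous fun y : EuclideanSpace ℝ (Fin 3) => ⟪y, e⟫ := continuous_id.inner continuous_const
    exact (measurableSet_lt measurable_const hc.measurable).inter
      (measurableSet_lt hc.measurable measurable_const)
  refine setLIntegral_sq_final_le hLH hT hSm (max_lt hT₁ hT) (by positivity) fun t ht => ?_
  have htI : t ∈ Ico 0 T := ⟨(le_max_right _ _).trans ht.1.le, ht.2⟩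
  have hcont : Continuous (u t) := (hcl.contDiff_velocity htI).continuous
  calc ∫⁻ y in {y : EuclideanSpace ℝ (Fin 3) | c - δ < ⟪y, e⟫ ∧ ⟪y, e⟫ < c + δ}, ‖u t y‖ₑ ^ 2
      ≤ ENNReal.ofReal (2 * δ) * ENNReal.ofReal M :=
        lintegral_dirSlab_le_of_planar hcont (fun R c' => hpl t ⟨(le_max_left _ _).trans_lt ht.1, ht.2⟩ R c') he c δ
    _ = ENNReal.ofReal (2 * δ * M) := by rw [← ENNReal.ofReal_mul (by positivity)]

/-- **Hardy ceiling at the final time.** Under the hypotheses of `dirSlab_final_le` (planar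
energies `≤ M` on a final stretch), the Newtonian potential of `|u(T)|²` is bounded by `2M` at
every centre: `∫ |u(T,y)|²/|y − x₀| dy ≤ 2M` (Radon back-projection, `stub_rieszCeiling`). -/
theorem hardyCeiling_final (hT : 0 < T) (hcl : IsClassicalNSSolutionOn (Ico 0 T) ν 0 u p)
    (hLH : IsLerayHopfOn T ν 0 u₀ u) {T₁ : ℝ} (hT₁ : T₁ < T) {M : ℝ} (hM : 0 ≤ M)
    (hpl : ∀ t ∈ Ioo T₁ T, ∀ (R : EuclideanSpace ℝ (Fin 3) ≃ₗᵢ[ℝ] EuclideanSpace ℝ (Fin 3)) (c : ℝ),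
      ∫⁻ y : EuclideanSpace ℝ (Fin 2), ‖u t (R (toLp 2 ![y 0, y 1, c]))‖ₑ ^ 2 ≤ ENNReal.ofReal M)
    (x₀ : EuclideanSpace ℝ (Fin 3)) :
    ∫⁻ y, ‖u T y‖ₑ ^ 2 / ‖y - x₀‖ₑ ≤ ENNReal.ofReal (2 * M) := by
  have h := stub_rieszCeiling (u T) (hLH.memLp T ⟨hT.le, le_rfl⟩).1 M hM
    (fun e he c δ hδ => dirSlab_final_le hT hcl hLH hT₁ hM hpl he c hδ) x₀
  simpa only [ofReal_norm] using h

/-- **Scaled energy at the final time**: under the same hypotheses,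
`∫_{B_r(x₀)} |u(T)|² ≤ 2rM` for every centre and radius `r > 0` (Seregin's Type-I-in-energy
bound survives at the blow-up time). -/
theorem ball_final_le (hT : 0 < T) (hcl : IsClassicalNSSolutionOn (Ico 0 T) ν 0 u p)
    (hLH : IsLerayHopfOn T ν 0 u₀ u) {T₁ : ℝ} (hT₁ : T₁ < T) {M : ℝ} (hM : 0 ≤ M)
    (hpl : ∀ t ∈ Ioo T₁ T, ∀ (R : EuclideanSpace ℝ (Fin 3) ≃ₗᵢ[ℝ] EuclideanSpace ℝ (Fin 3)) (c : ℝ),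
      ∫⁻ y : EuclideanSpace ℝ (Fin 2), ‖u t (R (toLp 2 ![y 0, y 1, c]))‖ₑ ^ 2 ≤ ENNReal.ofReal M)
    (x₀ : EuclideanSpace ℝ (Fin 3)) {r : ℝ} (hr : 0 < r) :
    ∫⁻ y in ball x₀ r, ‖u T y‖ₑ ^ 2 ≤ ENNReal.ofReal (2 * r * M) := by
  calc ∫⁻ y in ball x₀ r, ‖u T y‖ₑ ^ 2
      ≤ ENNReal.ofReal r * ∫⁻ y, ‖u T y‖ₑ ^ 2 / ‖y - x₀‖ₑ := lintegral_ball_le_of_hardy x₀ hr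
    _ ≤ ENNReal.ofReal r * ENNReal.ofReal (2 * M) := by
        gcongr
        exact hardyCeiling_final hT hcl hLH hT₁ hM hpl x₀
    _ = ENNReal.ofReal (2 * r * M) := by
        rw [← ENNReal.ofReal_mul hr.le]
        congr 1
        ring

/-! ## Given the crux -/

/-- **GIVEN the crux, the Hardy ceiling holds at the final time** for every classical Leray–Hopf
solution from a rapidly decaying datum: the bound `M` of `PlanarEnergyAPriori` on `[0,T)` passes
to the slice `u T` as `∫ |u(T,y)|²/|y−x₀| dy ≤ 2 max(M,0)` at every centre. At a blow-up time this
constrains the final profile: no `|y−x₀|⁻¹` tail (log-divergent potential). -/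
theorem PlanarEnergyAPriori.hardyCeiling_final
    (hcrux : Summit.NavierStokesRegularity.NavierStokesRegularity.Theses.PlaneEnergyCeiling.PlanarEnergyAPriori)
    (hν : 0 < ν) (hT : 0 < T) (hcl : IsClassicalNSSolutionOn (Ico 0 T) ν 0 u p)
    (hLH : IsLerayHopfOn T ν 0 (u 0) u) (hdec : HasRapidSpatialDecay (u 0)) :
    ∃ K : ℝ, 0 ≤ K ∧ ∀ x₀ : EuclideanSpace ℝ (Fin 3),
      ∫⁻ y, ‖u T y‖ₑ ^ 2 / ‖y - x₀‖ₑ ≤ ENNReal.ofReal K := by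
  obtain ⟨M, hM⟩ := hcrux ν T hν hT u p hcl hLH hdec
  refine ⟨2 * max M 0, by positivity, fun x₀ => ?_⟩
  refine Summit.NavierStokesRegularity.NavierStokesRegularity.Theorems.PlanarEnergyAPriori.hardyCeiling_final
    (T₁ := 0) hT hcl hLH hT (le_max_right M 0) (fun t ht R c => ?_) x₀
  exact (hM t ⟨ht.1.le, ht.2⟩ R c).trans (ENNReal.ofReal_le_ofReal (le_max_left _ _))

/-- **`hardyCeiling_final_of_planarEnergyAPriori`, registered form** (sub-goal of
stmt-NavierStokesRegularity-16855): `PlanarEnergyAPriori` ⟹ the final slice `u T` of every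
classical Leray–Hopf solution from a rapidly decaying datum on `[0,T)` has Newtonian potential of
`|u(T)|²` bounded at every centre. -/
theorem hardyCeiling_final_of_planarEnergyAPriori : Summit.NavierStokesRegularity.NavierStokesRegularity.Theses.PlaneEnergyCeiling.PlanarEnergyAPriori → ∀ (ν T : ℝ), 0 < ν → 0 < T → ∀ (u : ℝ → EuclideanSpace ℝ (Fin 3) → EuclideanSpace ℝ (Fin 3)) (p : ℝ → EuclideanSpace ℝ (Fin 3) → ℝ), Literature.Analysis.FluidPDE.IsClassicalNSSolutionOn (Set.Ico 0 T) ν 0 u p → Literature.Analysis.FluidPDE.IsLerayHopfOn T ν 0 (u 0) u → Literature.Analysis.FluidPDE.HasRapidSpatialDecay (u 0) → ∃ K : ℝ, ∀ x₀ : EuclideanSpace ℝ (Fin 3), ∫⁻ y, ‖u T y‖ₑ ^ 2 / ‖y - x₀‖ₑ ≤ ENNReal.ofReal K := by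
  intro hcrux ν T hν hT u p hcl hLH hdec
  obtain ⟨K, -, hK⟩ := PlanarEnergyAPriori.hardyCeiling_final hcrux hν hT hcl hLH hdec
  exact ⟨K, hK⟩

/-- **`hardyCeiling_final_of_planarBound`, registered form** (sub-goal of
stmt-NavierStokesRegularity-16855; the per-solution statement used by the sibling line
`radon_topside`, step (3) of its endgame): a planar bound `M ≥ 0` on `[0,T)` along a classical
solution that is Leray–Hopf on `[0,T]` gives `∫ |u(T,y)|²/|y−x₀| dy ≤ 2M` at every centre. -/
theorem hardyCeiling_final_of_planarBound : ∀ (ν T : ℝ), 0 < ν → 0 < T → ∀ (u : ℝ → EuclideanSpace ℝ (Fin 3) → EuclideanSpace ℝ (Fin 3)) (p : ℝ → EuclideanSpace ℝ (Fin 3) → ℝ), Literature.Analysis.FluidPDE.IsClassicalNSSolutionOn (Set.Ico 0 T) ν 0 u p → Literature.Analysis.FluidPDE.IsLerayHopfOn T ν 0 (u 0) u → ∀ M : ℝ, 0 ≤ M → (∀ t ∈ Set.Ico 0 T, ∀ (R : EuclideanSpace ℝ (Fin 3) ≃ₗᵢ[ℝ] EuclideanSpace ℝ (Fin 3)) (c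 : ℝ), ∫⁻ y : EuclideanSpace ℝ (Fin 2), ‖u t (R (WithLp.toLp 2 ![y 0, y 1, c]))‖ₑ ^ 2 ≤ ENNReal.ofReal M) → ∀ x₀ : EuclideanSpace ℝ (Fin 3), ∫⁻ y, ‖u T y‖ₑ ^ 2 / ‖y - x₀‖ₑ ≤ ENNReal.ofReal (2 * M) := by
  intro ν T _hν hT u p hcl hLH M hM hpl x₀
  exact hardyCeiling_final (T₁ := 0) hT hcl hLH hT hM (fun t ht R c => hpl t ⟨ht.1.le, ht.2⟩ R c) x₀

end Summit.NavierStokesRegularity.NavierStokesRegularity.Theorems.PlanarEnergyAPriori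

end
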